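import Summits.QuantumFields.YangMills.Theorems.ColdStartUniversalityLatticeLangevinRegularFlow
import Literature.Probability.Process.ProgressiveDensity
import HarnessLib

/-!
# Route `ColdStartUniversality`, rung `stub_fixedCutoffMixing` of K_A1 (stmt-QuantumFields-24809):
# observables along the regular flow are progressive (hence jointly measurable)

Helper file (seat `ym-line-csu-p1`, g6) for the step [2→SZZ] of the `WilsonMeasureLangevinInvariant` wall:
the Dynkin formula in expectation (`dynkin_expectation_flat_of_contDiff`) asks for JOINT measurability of the
process and PROGRESSIVE measurability of the coefficient processes.  For the regular solution flow
`exists_regularFlow` (g4) both follow from its measurability clause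
`(r, x, ω) ↦ U x r ω` measurable on `[0,i] × SU(2)^E × Ω` for `𝓑 ⊗ 𝓑 ⊗ 𝓕_i`:

* `isStronglyProgressive_comp_flow` — for every start `x` and measurable `φ : SU(2)^E → ℝ`,
  `(r, ω) ↦ φ(U x r ω)` is strongly progressive for `𝓕`;
* `measurable_comp_flow_toNNReal` — hence `(ω, r) ↦ φ(U x r⁺ ω)` is jointly measurable.

No definition, no sorry, standard axioms.  RECORD-rung plumbing (R3); the Yang–Mills mass gap is NOT proved.
-/

set_option autoImplicit false

noncomputable section

namespace Summit.QuantumFields.YangMills.Theorems.ColdStartUniversality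

open MeasureTheory ProbabilityTheory Filter
open scoped NNReal
open Literature.Probability.Process Literature.MathematicalPhysics.QuantumFieldTheory

variable {Ω : Type*} {mΩ : MeasurableSpace Ω} {𝓕 : Filtration ℝ≥0 mΩ} {L : ℕ}

/-- Measurability of a section of a jointly measurable map composed with an observable (all σ-algebras
explicit through the instances; used with the filtration σ-algebra on `Ω`). [folklore] -/
theorem measurable_comp_section {A G Ω' : Type*} [MeasurableSpace A] [MeasurableSpace G] [MeasurableSpace Ω']
    {V : A × (G × Ω') → G} (hV : Measurable V) (x : G) {φ : G → ℝ} (hφ : Measurable φ) :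
    Measurable fun p : A × Ω' => φ (V (p.1, (x, p.2))) :=
  hφ.comp (hV.comp (measurable_fst.prodMk (measurable_const.prodMk measurable_snd)))

/-- **Observables along a progressively measurable flow are progressive**: if `(r, x, ω) ↦ U x r ω` is
measurable on `[0,i] × SU(2)^E × Ω` for `𝓑 ⊗ 𝓑 ⊗ 𝓕_i` (every `i`), then for each start `x` and measurable
`φ`, `(r, ω) ↦ φ (U x r ω)` is strongly progressive for `𝓕`. [folklore] -/
theorem isStronglyProgressive_comp_flow
    {U : GaugeConfig 3 L (Matrix.specialUnitaryGroup (Fin 2) ℂ) → ℝ≥0 → Ω →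
      GaugeConfig 3 L (Matrix.specialUnitaryGroup (Fin 2) ℂ)}
    (hU : ∀ i : ℝ≥0, Measurable[@Prod.instMeasurableSpace (Set.Iic i)
        (GaugeConfig 3 L (Matrix.specialUnitaryGroup (Fin 2) ℂ) × Ω) inferInstance
        (@Prod.instMeasurableSpace (GaugeConfig 3 L (Matrix.specialUnitaryGroup (Fin 2) ℂ)) Ω inferInstance (𝓕 i))]
      (fun q : Set.Iic i × (GaugeConfig 3 L (Matrix.specialUnitaryGroup (Fin 2) ℂ) × Ω) => U q.2.1 q.1 q.2.2))
    (x : GaugeConfig 3 L (Matrix.specialUnitaryGroup (Fin 2) ℂ))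
    {φ : GaugeConfig 3 L (Matrix.specialUnitaryGroup (Fin 2) ℂ) → ℝ} (hφ : Measurable φ) :
    IsStronglyProgressive 𝓕 (fun r ω => φ (U x r ω)) := by
  intro i
  have h := @measurable_comp_section (Set.Iic i) (GaugeConfig 3 L (Matrix.specialUnitaryGroup (Fin 2) ℂ)) Ω
    inferInstance inferInstance (𝓕 i) _ (hU i) x φ hφ
  exact h.stronglyMeasurable

/-- **Joint measurability of observables along the regular flow**: under the same hypothesis,
`(ω, r) ↦ φ (U x r⁺ ω)` is measurable on `Ω × ℝ` (the `hXm`/coefficient input of the Dynkin formula). [folklore] -/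
theorem measurable_comp_flow_toNNReal
    {U : GaugeConfig 3 L (Matrix.specialUnitaryGroup (Fin 2) ℂ) → ℝ≥0 → Ω →
      GaugeConfig 3 L (Matrix.specialUnitaryGroup (Fin 2) ℂ)}
    (hU : ∀ i : ℝ≥0, Measurable[@Prod.instMeasurableSpace (Set.Iic i)
        (GaugeConfig 3 L (Matrix.specialUnitaryGroup (Fin 2) ℂ) × Ω) inferInstance
        (@Prod.instMeasurableSpace (GaugeConfig 3 L (Matrix.specialUnitaryGroup (Fin 2) ℂ)) Ω inferInstance (𝓕 i))]
      (fun q : Set.Iic i × (GaugeConfig 3 L (Matrix.specialUnitaryGroup (Fin 2) ℂ) × Ω) => U q.2.1 q.1 q.2.2))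
    (x : GaugeConfig 3 L (Matrix.specialUnitaryGroup (Fin 2) ℂ))
    {φ : GaugeConfig 3 L (Matrix.specialUnitaryGroup (Fin 2) ℂ) → ℝ} (hφ : Measurable φ) :
    Measurable fun p : Ω × ℝ => φ (U x p.2.toNNReal p.1) :=
  measurable_toNNReal_of_isStronglyProgressive (isStronglyProgressive_comp_flow hU x hφ)

end Summit.QuantumFields.YangMills.Theorems.ColdStartUniversality

end
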